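import Literature.NumberTheory.NumberFields.LenstraDifferentBound
import Mathlib.RingTheory.TensorProduct.Quotient
import Mathlib.RingTheory.TensorProduct.Free
import Mathlib.RingTheory.Trace.Quotient
import Mathlib.RingTheory.LocalRing.Quotient
import Mathlib.NumberTheory.RamificationInertia.Basic
import HarnessLib

/-!
# The Dedekind–Hensel different bound at every prime, without residual separability
# (Javanpeykar 2014, Prop. 4.1.3)

Topic `NumberTheory/NumberFields`. Theorem-only file (no definition, no named fact); sequel of
`Literature.NumberTheory.NumberFields.LenstraDifferentBound` (Prop. 4.1.1, the case where `B` is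
itself a discrete valuation ring).

Printed statement [cite: Javanpeykar2014, Prop. 4.1.3]: *Let `A` be a discrete valuation ring of
characteristic zero with fraction field `K`, and let `B` be the integral closure of `A` in a finite
field extension `L/K` of degree `n`. Suppose that the residue characteristic `p` of `A` is positive.
Let `m` be the biggest integer such that `p^m ≤ n`. Then, for `β ⊂ B` a maximal ideal of `B` with
ramification index `e_β` over `A`, the valuation `r_β` of the different ideal `𝔇_{B/A}` at `β`
satisfies `r_β ≤ e_β - 1 + e_β · ord_A(p^m)`.* The printed proof localises and completes at `β`
and applies Prop. 4.1.1 to the complete extension of degree `d = e_β f_β ≤ n`, getting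
`r_β ≤ e_β - 1 + e_β · ord_A(d)` and then `ord_A(d) ≤ ord_A(p^m)`.

## What is proved

The sharp intermediate form **`r_β ≤ e_β - 1 + e_β · ord_A(e_β f_β)`**, directly and without
completions, for `A` a discrete valuation ring (any characteristic), `B` a Dedekind domain finite
and torsion-free over `A`, `L = Frac B` separable over `K = Frac A`:

* `not_pow_dvd_differentIdeal_of_natCast_finrank_notMem` — with `𝔪 B = β^e · I`, `β + I = B`
  (`β` maximal, so `e = e_β`, `ramificationIdx'_eq_of_map_eq`) and `d = dim_κ (B ⧸ β^e)`
  (`κ = A ⧸ 𝔪`): if `d ∉ 𝔪^k` then **`β^{e k} ∤ 𝔇_{B/A}`**;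
* `finrank_quotient_pow_eq_mul` — `d = e · f` with `f = dim_κ (B ⧸ β)`, and hence
  `not_pow_dvd_differentIdeal_of_natCast_mul_finrank_notMem` — if `e f ∉ 𝔪^k` then
  `β^{e k} ∤ 𝔇_{B/A}`, i.e. `ord_β(𝔇_{B/A}) < e (ord_A(e f) + 1)`.

* `not_pow_dvd_differentIdeal_of_prime_pow_notMem` — **the printed form**: with `p ∈ 𝔪` prime (the
  residue characteristic) and `e f < p^{m+1}` (e.g. the biggest `m` with `p^m ≤ n`, since
  `e_β f_β ≤ n`): if `p^m ∉ 𝔪^k` then `β^{e k} ∤ 𝔇_{B/A}`, i.e. **`r_β ≤ e_β - 1 + e_β · ord_A(p^m)`**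
  (`natCast_prime_pow_mem_of_natCast_mem`: `e f = p^a u`, `a ≤ m`, `u ∈ A^×`).

In residue characteristic `0` (or prime to `e_β f_β`) the `e f`-form gives `r_β ≤ e_β - 1`, the
tame bound.

Auxiliary results of independent use: `trace_quotient_mk_eq` (the trace of `B ⧸ J B` over `A ⧸ J`
is the reduction of the trace, `B` finite free, any ideal `J`), `isLocalRing_quotient`,
`map_maximalIdeal_mk`, `free_of_linearEquiv_prod` (direct factors of free modules over local rings
are free), `free_quotient_of_mul_eq_map` and `finrank_quotient_eq_of_mul_eq_map` (freeness and
Nakayama rank of a coprime factor `B ⧸ P` of `B ⧸ J B` over `A ⧸ J`).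

## Proof (the trace argument of Prop. 4.1.1 run at one prime)

Put `P = β^{ek}`, `Q = I^k`; then `P Q = 𝔪^k B` and `P + Q = B`, so there is `y ∈ Q` with
`y ≡ 1 (mod P)`. By Mathlib's `not_dvd_differentIdeal_of_intTrace_not_mem` it suffices to show
`Tr_{B/A}(y) ∉ 𝔪^k`. Now `B` is free over the principal ideal domain `A`, so
`Tr_{B/A}(y) mod 𝔪^k = Tr_{(B/𝔪^kB)/(A/𝔪^k)}(ȳ)` (`trace_quotient_mk_eq`, base change of the trace);
`B/𝔪^kB ≅ B/P × B/Q` over the local ring `A/𝔪^k`, both factors are finite free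
(`free_quotient_of_mul_eq_map`), `ȳ = (1, 0)`, so the trace is the rank of `B/P` over `A/𝔪^k`,
which by Nakayama is `dim_κ (B/P)/𝔪(B/P) = dim_κ B/(P + 𝔪B) = dim_κ (B ⧸ β^e) = d`
(`finrank_quotient_eq_of_mul_eq_map`). Hence `Tr(y) ≡ d (mod 𝔪^k)`, and `d ∉ 𝔪^k` by hypothesis.

## References

* A. Javanpeykar, *Polynomial bounds for Arakelov invariants of Belyi curves*, Algebra & Number
  Theory 8 (2014) 89–140, arXiv:1403.6404, §4.1, Prop. 4.1.1, Remark 4.1.2, Prop. 4.1.3. [Javanpeykar2014]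
* J.-P. Serre, *Corps locaux*, Ch. III §6, Prop. 13 and the Remarque following it (the case of
  separable residue extensions, Dedekind–Hensel).
-/

namespace Literature.NumberTheory.NumberFields

open IsLocalRing nonZeroDivisors TensorProduct

section traceQuotient

variable {A B : Type*} [CommRing A] [CommRing B] [Algebra A B] [Module.Free A B] [Module.Finite A B]

/-- **Trace and reduction modulo an ideal.** For `B` finite free over `A` and any ideal `J ⊆ A`,
the trace of `(B ⧸ J B)/(A ⧸ J)` is the reduction of the trace of `B/A`:
`Tr_{(B/JB)/(A/J)}(x̄) = Tr_{B/A}(x) mod J` (base change of the trace along `A → A ⧸ J`,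
`B ⧸ JB ≅ (A ⧸ J) ⊗_A B`; Mathlib's `Algebra.trace_quotient_mk` is the case `J = 𝔪_A` of a local
ring). [folklore] -/
theorem trace_quotient_mk_eq (J : Ideal A) (x : B) :
    Algebra.trace (A ⧸ J) (B ⧸ J.map (algebraMap A B)) (Ideal.Quotient.mk _ x) =
      Ideal.Quotient.mk J (Algebra.trace A B x) := by
  have h1 : Algebra.trace (A ⧸ J) (B ⧸ J.map (algebraMap A B)) (Ideal.Quotient.mk _ x) =
      Algebra.trace (A ⧸ J) ((A ⧸ J) ⊗[A] B) (1 ⊗ₜ x) := by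
    rw [← Algebra.TensorProduct.quotIdealMapEquivQuotTensor_mk,
      Algebra.trace_eq_of_algEquiv]
  rw [h1, Algebra.trace_apply, ← Algebra.baseChange_lmul, LinearMap.trace_baseChange,
    Ideal.Quotient.algebraMap_eq, Algebra.trace_apply]

end traceQuotient

/-! ### Quotients of a local ring and of a free algebra over it by powers of the maximal ideal -/

section localQuot

variable {A : Type*} [CommRing A] [IsLocalRing A]

/-- A proper quotient of a local ring is local. [folklore] -/
theorem isLocalRing_quotient {J : Ideal A} (hJ : J ≠ ⊤) : IsLocalRing (A ⧸ J) :=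
  haveI : Nontrivial (A ⧸ J) := Ideal.Quotient.nontrivial_iff.mpr hJ
  IsLocalRing.of_surjective' (Ideal.Quotient.mk J) Ideal.Quotient.mk_surjective

/-- The maximal ideal of a proper quotient `A ⧸ J` of a local ring is the image of `𝔪_A`. [folklore] -/
theorem map_maximalIdeal_mk {J : Ideal A} (hJ : J ≠ ⊤) :
    haveI := isLocalRing_quotient hJ
    (maximalIdeal A).map (Ideal.Quotient.mk J) = maximalIdeal (A ⧸ J) := by
  haveI := isLocalRing_quotient hJ
  haveI : Nontrivial (A ⧸ J) := Ideal.Quotient.nontrivial_iff.mpr hJ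
  haveI := IsLocalHom.of_surjective (Ideal.Quotient.mk J) Ideal.Quotient.mk_surjective
  ext x
  obtain ⟨x, rfl⟩ := Ideal.Quotient.mk_surjective x
  simp [sup_eq_left.mpr (le_maximalIdeal hJ)]

/-- **A direct factor of a finite free algebra over a local ring is free**: if `M ≃ S × T`
linearly over the local ring `R` with `M` free and `S` finite, then `S` is free (a direct summand of
a projective module is projective, and finite projective modules over local rings are free).
[folklore] -/
theorem free_of_linearEquiv_prod {R M S T : Type*} [CommRing R] [IsLocalRing R] [AddCommGroup M]
    [Module R M] [AddCommGroup S] [Module R S] [AddCommGroup T] [Module R T] [Module.Free R M]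
    [Module.Finite R S] (ε : M ≃ₗ[R] S × T) : Module.Free R S := by
  haveI : Module.Projective R (S × T) := Module.Projective.of_equiv' ε
  haveI : Module.Projective R S :=
    Module.Projective.of_split (LinearMap.inl R S T) (LinearMap.fst R S T)
      (LinearMap.fst_comp_inl R S T)
  exact Module.free_of_flat_of_isLocalRing

end localQuot

/-! ### `B ⧸ P` over `A ⧸ J` for `J B = P Q`: freeness and rank -/

section rank

variable {A B : Type*} [CommRing A] [IsLocalRing A] [CommRing B] [Algebra A B] [Module.Free A B]
  [Module.Finite A B]

/-- **A coprime factor of `B ⧸ J B` is finite free over `A ⧸ J`.** Let `A` be local, `B` a finite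
free `A`-algebra, `J` a proper ideal of `A` and `J B = P Q` with `P`, `Q` coprime ideals of `B`.
Then `B ⧸ P` — a direct factor of the free `A ⧸ J`-algebra `B ⧸ J B ≅ (B ⧸ P) × (B ⧸ Q)` — is
free over the local ring `A ⧸ J`. [folklore] -/
theorem free_quotient_of_mul_eq_map {J : Ideal A} (hJ : J ≠ ⊤) {P Q : Ideal B}
    (hPQ : P * Q = J.map (algebraMap A B)) (hcop : IsCoprime P Q)
    (hle : J ≤ P.comap (algebraMap A B)) :
    letI := Ideal.Quotient.algebraQuotientOfLEComap hle
    Module.Free (A ⧸ J) (B ⧸ P) := by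
  letI : Algebra (A ⧸ J) (B ⧸ P) := Ideal.Quotient.algebraQuotientOfLEComap hle
  haveI : IsScalarTower A (A ⧸ J) (B ⧸ P) := IsScalarTower.of_algebraMap_eq' rfl
  have hleQ : J ≤ Q.comap (algebraMap A B) := by
    rw [← Ideal.map_le_iff_le_comap, ← hPQ]; exact Ideal.mul_le_left
  letI : Algebra (A ⧸ J) (B ⧸ Q) := Ideal.Quotient.algebraQuotientOfLEComap hleQ
  haveI : IsScalarTower A (A ⧸ J) (B ⧸ Q) := IsScalarTower.of_algebraMap_eq' rfl
  haveI : IsLocalRing (A ⧸ J) := isLocalRing_quotient hJ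
  haveI : Module.Finite (A ⧸ J) (B ⧸ P) := Module.Finite.of_restrictScalars_finite A _ _
  haveI : Module.Free (A ⧸ J) (B ⧸ J.map (algebraMap A B)) :=
    Module.Free.of_equiv (Algebra.TensorProduct.quotIdealMapEquivQuotTensor B J).symm.toLinearEquiv
  let ε : (B ⧸ J.map (algebraMap A B)) ≃ₐ[A ⧸ J] (B ⧸ P) × B ⧸ Q :=
    { __ := (Ideal.quotEquivOfEq hPQ.symm).trans (Ideal.quotientMulEquivQuotientProd P Q hcop),
      commutes' := Quotient.ind fun _ ↦ rfl }
  exact free_of_linearEquiv_prod ε.toLinearEquiv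

/-- **Rank of a coprime factor modulo `J ⊆ 𝔪`.** In the situation of `free_quotient_of_mul_eq_map`
with moreover `J ⊆ 𝔪 = 𝔪_A`, the rank of the free `A ⧸ J`-module `B ⧸ P` is the dimension over the
residue field `A ⧸ 𝔪` of `B ⧸ (P + 𝔪 B)` (Nakayama: the rank of a finite free module over a local
ring is the dimension of its reduction modulo the maximal ideal; here
`(B ⧸ P) ⧸ 𝔪 (B ⧸ P) = B ⧸ (P + 𝔪 B)`). [folklore] -/
theorem finrank_quotient_eq_of_mul_eq_map {J : Ideal A} (hJ : J ≠ ⊤) (hJm : J ≤ maximalIdeal A)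
    {P Q : Ideal B} (hPQ : P * Q = J.map (algebraMap A B)) (hcop : IsCoprime P Q)
    {P₁ : Ideal B} (hP₁ : P ⊔ (maximalIdeal A).map (algebraMap A B) = P₁)
    [P₁.LiesOver (maximalIdeal A)] (hle : J ≤ P.comap (algebraMap A B)) :
    letI := Ideal.Quotient.algebraQuotientOfLEComap hle
    Module.finrank (A ⧸ J) (B ⧸ P) = Module.finrank (A ⧸ maximalIdeal A) (B ⧸ P₁) := by
  letI : Algebra (A ⧸ J) (B ⧸ P) := Ideal.Quotient.algebraQuotientOfLEComap hle
  haveI : IsScalarTower A (A ⧸ J) (B ⧸ P) := IsScalarTower.of_algebraMap_eq' rfl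
  haveI : IsLocalRing (A ⧸ J) := isLocalRing_quotient hJ
  haveI : Module.Finite (A ⧸ J) (B ⧸ P) := Module.Finite.of_restrictScalars_finite A _ _
  haveI : Module.Free (A ⧸ J) (B ⧸ P) := free_quotient_of_mul_eq_map hJ hPQ hcop hle
  -- Nakayama: the rank is the dimension of the reduction modulo the maximal ideal of `A ⧸ J`
  rw [← IsLocalRing.finrank_quotient_map (R := A ⧸ J) (S := B ⧸ P)]
  -- identify `(A ⧸ J) ⧸ 𝔪'` with `A ⧸ 𝔪` and `(B ⧸ P) ⧸ 𝔪'(B ⧸ P)` with `B ⧸ (P ⊔ 𝔪 B) = B ⧸ P₁`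
  have hmax : maximalIdeal (A ⧸ J) = (maximalIdeal A).map (Ideal.Quotient.mk J) :=
    (map_maximalIdeal_mk hJ).symm
  have hmapeq : (maximalIdeal (A ⧸ J)).map (algebraMap (A ⧸ J) (B ⧸ P)) =
      ((maximalIdeal A).map (algebraMap A B)).map (Ideal.Quotient.mk P) := by
    rw [hmax, Ideal.map_map, Ideal.map_map]
    congr 1
  let i : (A ⧸ J) ⧸ maximalIdeal (A ⧸ J) ≃+* A ⧸ maximalIdeal A :=
    (Ideal.quotEquivOfEq hmax).trans (DoubleQuot.quotQuotEquivQuotOfLE hJm)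
  let j : (B ⧸ P) ⧸ (maximalIdeal (A ⧸ J)).map (algebraMap (A ⧸ J) (B ⧸ P)) ≃+* B ⧸ P₁ :=
    (Ideal.quotEquivOfEq hmapeq).trans
      ((DoubleQuot.quotQuotEquivQuotSup P ((maximalIdeal A).map (algebraMap A B))).trans
        (Ideal.quotEquivOfEq hP₁))
  refine Algebra.finrank_eq_of_equiv_equiv i j ?_
  refine Ideal.Quotient.ringHom_ext (Ideal.Quotient.ringHom_ext (RingHom.ext fun x ↦ ?_))
  rfl

end rank

/-! ### Integers in a local ring of residue characteristic `p` -/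

section residueChar

variable {A : Type*} [CommRing A] [IsLocalRing A]

/-- In a local ring `A` with `p ∈ 𝔪_A` (`p` a prime number), an integer prime to `p` is a unit:
`x u + y p = 1` in `ℤ` gives `x u + y p = 1` in `A` with `y p ∈ 𝔪_A`. [folklore] -/
theorem isUnit_natCast_of_not_dvd {p u : ℕ} (hp : p.Prime) (hpA : (p : A) ∈ maximalIdeal A)
    (hu : ¬ p ∣ u) : IsUnit (u : A) := by
  have hcop : IsCoprime (u : A) (p : A) := by
    simpa only [map_natCast] using
      IsCoprime.map (Nat.Coprime.isCoprime ((hp.coprime_iff_not_dvd).2 hu).symm) (Int.castRingHom A)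
  obtain ⟨x, y, hxy⟩ := hcop
  by_contra hunit
  have h1 : x * u + y * p ∈ maximalIdeal A :=
    add_mem (Ideal.mul_mem_left _ _ ((IsLocalRing.mem_maximalIdeal _).2 hunit))
      (Ideal.mul_mem_left _ _ hpA)
  rw [hxy] at h1
  exact (maximalIdeal.isMaximal A).ne_top ((Ideal.eq_top_iff_one _).2 h1)

/-- In a local ring `A` with `p ∈ 𝔪_A` (`p` prime): if `0 < d < p^{m+1}` and `d ∈ J` for an ideal `J`,
then `p^m ∈ J` — write `d = p^a u`, `p ∤ u`, so `a ≤ m` and `u` is a unit (the step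
`ord_A(d) ≤ ord_A(p^m)` of [cite: Javanpeykar2014, Prop. 4.1.3]). [folklore] -/
theorem natCast_prime_pow_mem_of_natCast_mem {p m d : ℕ} (hp : p.Prime)
    (hpA : (p : A) ∈ maximalIdeal A) (hd0 : d ≠ 0) (hlt : d < p ^ (m + 1)) {J : Ideal A}
    (hdJ : (d : A) ∈ J) : (p : A) ^ m ∈ J := by
  obtain ⟨a, u, hu, rfl⟩ := Nat.exists_eq_pow_mul_and_not_dvd hd0 p hp.one_lt.ne'
  have hu0 : u ≠ 0 := by
    rintro rfl
    exact hd0 (mul_zero _)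
  have ha : a ≤ m := by
    have h : p ^ a < p ^ (m + 1) :=
      lt_of_le_of_lt (Nat.le_mul_of_pos_right _ (Nat.pos_of_ne_zero hu0)) hlt
    exact Nat.lt_succ_iff.1 ((Nat.pow_lt_pow_iff_right hp.one_lt).1 h)
  rw [Nat.cast_mul, Nat.cast_pow, Ideal.mul_unit_mem_iff_mem _ (isUnit_natCast_of_not_dvd hp hpA hu)]
    at hdJ
  obtain ⟨c, rfl⟩ := Nat.exists_eq_add_of_le ha
  rw [pow_add]
  exact Ideal.mul_mem_right _ _ hdJ

end residueChar

/-! ### Javanpeykar 2014, Prop. 4.1.3: the bound at every prime of `B` (A a discrete valuation ring) -/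

section Hensel

variable (A K L B : Type*) [CommRing A] [IsDomain A] [IsDiscreteValuationRing A] [Field K]
  [Algebra A K] [IsFractionRing A K] [CommRing B] [IsDedekindDomain B] [Field L]
  [Algebra B L] [IsFractionRing B L] [Algebra A B] [Module.Finite A B] [Module.IsTorsionFree A B]
  [Algebra K L] [Algebra A L] [IsScalarTower A K L] [IsScalarTower A B L] [Algebra.IsSeparable K L]

include K L in
/-- **The Dedekind–Hensel–Lenstra bound at an arbitrary prime** ([cite: Javanpeykar2014, Prop. 4.1.3],
in the sharp form of its proof). Let `A` be a discrete valuation ring with fraction field `K`,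
maximal ideal `𝔪` and residue field `κ = A ⧸ 𝔪`; `B` a Dedekind domain, finite and torsion-free
over `A`, with fraction field `L`, `L/K` finite separable; `β` a maximal ideal of `B` with
`𝔪 B = β ^ e · I`, `β + I = B` (so `e = e_β` is the ramification index), and let
`d = dim_κ (B ⧸ β ^ e)` (`= e_β f_β`, the local degree at `β`). If `d ∉ 𝔪 ^ k` — i.e.
`k > ord_A(e_β f_β)` — then `β ^ (e k) ∤ 𝔇_{B/A}`; that is, **`ord_β(𝔇_{B/A}) ≤ e_β - 1 + e_β · ord_A(e_β f_β)`**.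
Since `e_β f_β ≤ n = [L : K]`, `ord_A(e_β f_β) ≤ ord_A(p^m)` for the largest `p^m ≤ n` (`p` the
residue characteristic), which is the printed `r_β ≤ e_β - 1 + e_β · ord_A(p^m)`; the source obtains it
from Prop. 4.1.1 after localising and completing at `β`, here it is proved directly: with
`P = β^{ek}`, `Q = I^k` one has `P Q = 𝔪^k B`; pick `y ≡ 1 (mod P)`, `y ≡ 0 (mod Q)`; then
`Tr_{B/A}(y) ≡ Tr_{(B/𝔪^kB)/(A/𝔪^k)}(ȳ) = rank_{A/𝔪^k}(B ⧸ P) = d (mod 𝔪^k)`, so `Tr(y) ∉ 𝔪^k`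
and Mathlib's `not_dvd_differentIdeal_of_intTrace_not_mem` applies. [cite: Javanpeykar2014, Prop. 4.1.3] -/
theorem not_pow_dvd_differentIdeal_of_natCast_finrank_notMem (β : Ideal B) [β.IsMaximal] {e : ℕ}
    {I : Ideal B} (hfac : (maximalIdeal A).map (algebraMap A B) = β ^ e * I) (hcop : β ⊔ I = ⊤)
    [(β ^ e).LiesOver (maximalIdeal A)] {k : ℕ}
    (hd : ((Module.finrank (A ⧸ maximalIdeal A) (B ⧸ β ^ e) : ℕ) : A) ∉ maximalIdeal A ^ k) :
    ¬ β ^ (e * k) ∣ differentIdeal A B := by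
  classical
  -- `k = 0` is vacuous
  rcases Nat.eq_zero_or_pos k with hk | hk
  · subst hk
    rw [pow_zero, Ideal.one_eq_top] at hd
    exact absurd Submodule.mem_top hd
  haveI : Module.Free A B := Module.free_of_finite_type_torsion_free'
  letI := FractionRing.liftAlgebra A (FractionRing B)
  haveI : Algebra.IsSeparable (FractionRing A) (FractionRing B) :=
    isSeparable_fractionRing_of_isSeparable A K L B
  set 𝔪 := maximalIdeal A with h𝔪
  -- the ideals `P = β^{ek}`, `Q = I^k`, `P Q = 𝔪^k B`, `P + Q = B`
  have hJm : 𝔪 ^ k ≤ 𝔪 := Ideal.pow_le_self hk.ne'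
  have hJ : 𝔪 ^ k ≠ ⊤ := fun h ↦
    (maximalIdeal.isMaximal A).ne_top (top_le_iff.1 (by rw [h] at hJm; exact hJm))
  set P := β ^ (e * k) with hP
  set Q := I ^ k with hQ
  have hPQ : P * Q = (𝔪 ^ k).map (algebraMap A B) := by
    rw [Ideal.map_pow, hfac, mul_pow, ← pow_mul]
  have hsupPQ : P ⊔ Q = ⊤ := Ideal.pow_sup_pow_eq_top hcop
  have hcopPQ : IsCoprime P Q := Ideal.isCoprime_iff_sup_eq.2 hsupPQ
  have hle : 𝔪 ^ k ≤ P.comap (algebraMap A B) := by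
    rw [← Ideal.map_le_iff_le_comap, ← hPQ]; exact Ideal.mul_le_right
  have hleQ : 𝔪 ^ k ≤ Q.comap (algebraMap A B) := by
    rw [← Ideal.map_le_iff_le_comap, ← hPQ]; exact Ideal.mul_le_left
  -- `P + 𝔪 B = β ^ e`
  have hP₁ : P ⊔ 𝔪.map (algebraMap A B) = β ^ e := by
    obtain ⟨k', rfl⟩ := Nat.exists_eq_add_of_le hk
    rw [hP, hfac, show e * (1 + k') = e + e * k' by ring, pow_add, ← Ideal.mul_sup,
      Ideal.pow_sup_eq_top hcop, Ideal.mul_top]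
  -- the element `y ≡ 1 (mod P)`, `y ∈ Q`
  obtain ⟨a, ha, y, hy, hay⟩ := Submodule.mem_sup.1 ((Ideal.eq_top_iff_one _).1 hsupPQ)
  refine not_dvd_differentIdeal_of_intTrace_not_mem A P Q hPQ y hy ?_
  -- the algebra structures over `A ⧸ 𝔪^k`
  letI : Algebra (A ⧸ 𝔪 ^ k) (B ⧸ P) := Ideal.Quotient.algebraQuotientOfLEComap hle
  haveI : IsScalarTower A (A ⧸ 𝔪 ^ k) (B ⧸ P) := IsScalarTower.of_algebraMap_eq' rfl
  letI : Algebra (A ⧸ 𝔪 ^ k) (B ⧸ Q) := Ideal.Quotient.algebraQuotientOfLEComap hleQ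
  haveI : IsScalarTower A (A ⧸ 𝔪 ^ k) (B ⧸ Q) := IsScalarTower.of_algebraMap_eq' rfl
  haveI : IsLocalRing (A ⧸ 𝔪 ^ k) := isLocalRing_quotient hJ
  haveI : Module.Finite (A ⧸ 𝔪 ^ k) (B ⧸ P) := Module.Finite.of_restrictScalars_finite A _ _
  haveI : Module.Finite (A ⧸ 𝔪 ^ k) (B ⧸ Q) := Module.Finite.of_restrictScalars_finite A _ _
  haveI : Module.Free (A ⧸ 𝔪 ^ k) (B ⧸ P) := free_quotient_of_mul_eq_map hJ hPQ hcopPQ hle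
  haveI : Module.Free (A ⧸ 𝔪 ^ k) (B ⧸ Q) :=
    free_quotient_of_mul_eq_map hJ ((mul_comm Q P).trans hPQ) hcopPQ.symm hleQ
  have hrank : Module.finrank (A ⧸ 𝔪 ^ k) (B ⧸ P) = Module.finrank (A ⧸ 𝔪) (B ⧸ β ^ e) :=
    finrank_quotient_eq_of_mul_eq_map hJ hJm hPQ hcopPQ hP₁ hle
  -- `B ⧸ 𝔪^k B ≅ (B ⧸ P) × (B ⧸ Q)` over `A ⧸ 𝔪^k`
  let ε : (B ⧸ (𝔪 ^ k).map (algebraMap A B)) ≃ₐ[A ⧸ 𝔪 ^ k] (B ⧸ P) × B ⧸ Q :=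
    { __ := (Ideal.quotEquivOfEq hPQ.symm).trans (Ideal.quotientMulEquivQuotientProd P Q hcopPQ),
      commutes' := Quotient.ind fun _ ↦ rfl }
  have hε1 : (ε (Ideal.Quotient.mk _ y)).1 = 1 := by
    change Ideal.Quotient.mk P y = 1
    rw [← (Ideal.Quotient.mk P).map_one, Ideal.Quotient.eq]
    have : y - 1 = -a := by rw [← hay]; ring
    rw [this]
    exact neg_mem ha
  have hε2 : (ε (Ideal.Quotient.mk _ y)).2 = 0 := by
    change Ideal.Quotient.mk Q y = 0
    exact Ideal.Quotient.eq_zero_iff_mem.2 hy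
  -- the trace of `y` modulo `𝔪^k` is the rank `d`
  have htr : Ideal.Quotient.mk (𝔪 ^ k) (Algebra.intTrace A B y) =
      (Module.finrank (A ⧸ 𝔪) (B ⧸ β ^ e) : A ⧸ 𝔪 ^ k) := by
    rw [Algebra.intTrace_eq_trace, ← trace_quotient_mk_eq, ← Algebra.trace_eq_of_algEquiv ε,
      Algebra.trace_prod_apply, hε1, hε2, map_zero, add_zero,
      ← (algebraMap (A ⧸ 𝔪 ^ k) (B ⧸ P)).map_one, Algebra.trace_algebraMap, hrank, nsmul_eq_mul,
      mul_one]
  intro hmem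
  apply hd
  rw [← Ideal.Quotient.eq_zero_iff_mem] at hmem ⊢
  rw [map_natCast, ← htr, hmem]

omit [Field K] [Algebra A K] [IsFractionRing A K] [Field L] [Algebra B L] [IsFractionRing B L]
  [Algebra K L] [Algebra A L] [IsScalarTower A K L] [IsScalarTower A B L] [Algebra.IsSeparable K L]
  [Module.Finite A B] in
/-- In the situation `𝔪 B = β ^ e · I`, `β + I = B` (`β` maximal), `e` is Mathlib's ramification index
`Ideal.ramificationIdx' 𝔪 β` of `β` over `𝔪`. [folklore] -/
theorem ramificationIdx'_eq_of_map_eq (β : Ideal B) [β.IsMaximal] {e : ℕ} {I : Ideal B}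
    (hfac : (maximalIdeal A).map (algebraMap A B) = β ^ e * I) (hcop : β ⊔ I = ⊤) :
    Ideal.ramificationIdx' (maximalIdeal A) β = e := by
  have hmap0 : (maximalIdeal A).map (algebraMap A B) ≠ ⊥ := by
    rw [Ne, Ideal.map_eq_bot_iff_of_injective (FaithfulSMul.algebraMap_injective A B)]
    exact IsDiscreteValuationRing.not_a_field A
  have hβe : β ^ e ≠ 0 := fun h ↦ hmap0 (by rw [hfac, h, zero_mul, Ideal.zero_eq_bot])
  refine Ideal.ramificationIdx'_spec (by rw [hfac]; exact Ideal.mul_le_right) fun hle ↦ ?_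
  rw [hfac, pow_succ, ← Ideal.dvd_iff_le, mul_dvd_mul_iff_left hβe, Ideal.dvd_iff_le] at hle
  have h : β ⊔ I ≤ β := sup_le le_rfl hle
  rw [hcop, top_le_iff] at h
  exact Ideal.IsMaximal.ne_top ‹β.IsMaximal› h

omit [Field K] [Algebra A K] [IsFractionRing A K] [Field L] [Algebra B L] [IsFractionRing B L]
  [Algebra K L] [Algebra A L] [IsScalarTower A K L] [IsScalarTower A B L] [Algebra.IsSeparable K L]
  [Module.Finite A B] in
/-- **The local degree is `e f`**: in the situation `𝔪 B = β ^ e · I`, `β + I = B`, `e ≠ 0`,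
`dim_κ (B ⧸ β ^ e) = e · dim_κ (B ⧸ β)` with `κ = A ⧸ 𝔪` (Mathlib's
`Ideal.finrank_prime_pow_ramificationIdx`, the filtration `β^i ⧸ β^{i+1} ≅ B ⧸ β`). [folklore] -/
theorem finrank_quotient_pow_eq_mul (β : Ideal B) [β.IsMaximal] {e : ℕ} {I : Ideal B}
    (hfac : (maximalIdeal A).map (algebraMap A B) = β ^ e * I) (hcop : β ⊔ I = ⊤) (he : e ≠ 0)
    [(β ^ e).LiesOver (maximalIdeal A)] [β.LiesOver (maximalIdeal A)] :
    Module.finrank (A ⧸ maximalIdeal A) (B ⧸ β ^ e) =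
      e * Module.finrank (A ⧸ maximalIdeal A) (B ⧸ β) := by
  have hram := ramificationIdx'_eq_of_map_eq A B β hfac hcop
  have hβ0 : β ≠ ⊥ := by
    rintro rfl
    rw [← Ideal.zero_eq_bot, zero_pow he, zero_mul, Ideal.zero_eq_bot,
      Ideal.map_eq_bot_iff_of_injective (FaithfulSMul.algebraMap_injective A B)] at hfac
    exact IsDiscreteValuationRing.not_a_field A hfac
  subst hram
  haveI : NeZero (Ideal.ramificationIdx' (maximalIdeal A) β) := ⟨he⟩
  convert Ideal.finrank_prime_pow_ramificationIdx (maximalIdeal A) β hβ0 he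

include K L in
/-- **Javanpeykar 2014, Prop. 4.1.3, with the local degree spelled out as `e f`.** `A` a discrete
valuation ring (`𝔪`, `κ = A ⧸ 𝔪`), `B` Dedekind, finite torsion-free over `A`, `L = Frac B` finite
separable over `K = Frac A`, `β` a maximal ideal of `B` with `𝔪 B = β ^ e · I`, `β + I = B`,
`f = dim_κ (B ⧸ β)` its residue degree. If `e f ∉ 𝔪 ^ k` then `β ^ (e k) ∤ 𝔇_{B/A}`:
**`ord_β(𝔇_{B/A}) ≤ e - 1 + e · ord_A(e f)`** (and `ord_A(e f) ≤ ord_A(p^m)` for `p^m ≤ [L:K] < p^{m+1}`,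
`p` the residue characteristic, recovers the printed `r_β ≤ e_β - 1 + e_β · ord_A(p^m)`).
[cite: Javanpeykar2014, Prop. 4.1.3] -/
theorem not_pow_dvd_differentIdeal_of_natCast_mul_finrank_notMem (β : Ideal B) [β.IsMaximal]
    {e : ℕ} {I : Ideal B} (hfac : (maximalIdeal A).map (algebraMap A B) = β ^ e * I)
    (hcop : β ⊔ I = ⊤) [(β ^ e).LiesOver (maximalIdeal A)] [β.LiesOver (maximalIdeal A)] {k : ℕ}
    (hd : ((e * Module.finrank (A ⧸ maximalIdeal A) (B ⧸ β) : ℕ) : A) ∉ maximalIdeal A ^ k) :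
    ¬ β ^ (e * k) ∣ differentIdeal A B := by
  rcases Nat.eq_zero_or_pos e with he | he
  · subst he
    rw [zero_mul, pow_zero, Ideal.one_eq_top]
    rw [zero_mul, Nat.cast_zero] at hd
    exact absurd (Ideal.zero_mem _) hd
  refine not_pow_dvd_differentIdeal_of_natCast_finrank_notMem A K L B β hfac hcop ?_
  rwa [finrank_quotient_pow_eq_mul A B β hfac hcop he.ne']

include K L in
/-- **Javanpeykar 2014, Prop. 4.1.3, as printed.** `A` a discrete valuation ring with `p ∈ 𝔪_A`
(`p` a prime number: the residue characteristic), `B` Dedekind, finite torsion-free over `A`,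
`L = Frac B` separable over `K = Frac A`, `β` maximal with `𝔪 B = β^e · I`, `β + I = B`, residue
degree `f = dim_κ (B ⧸ β)`, and `m` with `e f < p^{m+1}` (e.g. the biggest `m` with `p^m ≤ n = [L:K]`,
as `e f ≤ n`). Then for every `k` with `p^m ∉ 𝔪^k` — i.e. `k > ord_A(p^m)` — `β^{e k} ∤ 𝔇_{B/A}`:
**`r_β ≤ e_β - 1 + e_β · ord_A(p^m)`**. (From the `e f`-form: `e f = p^a u` with `a ≤ m`, `p ∤ u`,
`u` a unit of `A`, so `e f ∈ 𝔪^k ⇒ p^m ∈ 𝔪^k`.) [cite: Javanpeykar2014, Prop. 4.1.3] -/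
theorem not_pow_dvd_differentIdeal_of_prime_pow_notMem (β : Ideal B) [β.IsMaximal] {e : ℕ}
    {I : Ideal B} (hfac : (maximalIdeal A).map (algebraMap A B) = β ^ e * I) (hcop : β ⊔ I = ⊤)
    [(β ^ e).LiesOver (maximalIdeal A)] [β.LiesOver (maximalIdeal A)] {p m k : ℕ} (hp : p.Prime)
    (hpA : (p : A) ∈ maximalIdeal A)
    (hlt : e * Module.finrank (A ⧸ maximalIdeal A) (B ⧸ β) < p ^ (m + 1))
    (hpm : (p : A) ^ m ∉ maximalIdeal A ^ k) : ¬ β ^ (e * k) ∣ differentIdeal A B := by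
  refine not_pow_dvd_differentIdeal_of_natCast_mul_finrank_notMem A K L B β hfac hcop
    fun hmem ↦ hpm (natCast_prime_pow_mem_of_natCast_mem hp hpA ?_ hlt hmem)
  -- `e f ≠ 0`
  have he : e ≠ 0 := by
    rintro rfl
    rw [pow_zero, one_mul] at hfac
    have hle : (maximalIdeal A).map (algebraMap A B) ≤ β :=
      Ideal.map_le_iff_le_comap.2 (le_of_eq (Ideal.over_def β (maximalIdeal A)))
    rw [hfac] at hle
    have h : β ⊔ I ≤ β := sup_le le_rfl hle
    rw [hcop, top_le_iff] at h
    exact Ideal.IsMaximal.ne_top ‹β.IsMaximal› h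
  have hf : Module.finrank (A ⧸ maximalIdeal A) (B ⧸ β) ≠ 0 := by
    letI := Ideal.Quotient.field (maximalIdeal A)
    haveI : Module.Finite (A ⧸ maximalIdeal A) (B ⧸ β) :=
      Module.Finite.of_restrictScalars_finite A _ _
    haveI : Nontrivial (B ⧸ β) := Ideal.Quotient.nontrivial_iff.2 (Ideal.IsMaximal.ne_top ‹_›)
    exact Module.finrank_pos.ne'
  exact mul_ne_zero he hf

end Hensel

end Literature.NumberTheory.NumberFields
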